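import Summits.BirchSwinnertonDyer.BirchSwinnertonDyer.Theorems.PrintCf2RubinValueTwoKatzMeasureJZeroSeamValuesReadingField
import Summits.BirchSwinnertonDyer.BirchSwinnertonDyer.Theorems.PrintCf2RubinValueTwoKatzMeasureJZeroSeamValuesOfLabelData
import Summits.BirchSwinnertonDyer.BirchSwinnertonDyer.Theorems.PrintCf2RubinValueTwoKatzMeasureJZeroFrameSevenConjugate
import Literature.NumberTheory.NumberFields.RayClassFieldArtinSymbolSurjective
import HarnessLib

/-!
# The REFERENCE BLOCK of the `j = 0` seam: the `v̄³`-presentation of the model lattice, its division points and Tate unit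
# ([I2] FILE-4, piece (c))

Cell `bsd-print-cf2`, LEAD seat `bsd-line-cf2-p1` g20, crux `stmt-BirchSwinnertonDyer-20368` (`PrintCf2.SplitBadTwoRankOneOfFacts`),
registered skeleton v14.10, BRIDGE stub `stub_perLevelBridge_two` (= `P1`).  The per-level socket
`KatzMeasureJZeroSeam.forall_label_moment_eq_at_level` (FILE-3b, -w8 g14) takes as hypotheses a REFERENCE presentation
`Λ_L = Ω_ref·w₀((1 − α₀)³)`, `Ω_ref = Ω_E / w₀((1 − α₀)³)`, of the model lattice `Λ_L = Ω_E·w₀(𝓞_K)` of `W = [1,−1,0,−2,−1]`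
together with `β_r α₀ ≡ 1 (mod v̄³)`, the readings `xu₀ m, yu₀ m` / `XU₀ m, YU₀ m` of its `v`-division points
`u_{m+1} = β_r^{m+1}Ω_ref − Ω_ref/α₀^{m+1}` in a finite Galois unramified reading field `E₀`, and their Tate unit `a₀` with B10a's point
property (`P(h([a₀] ω_{m+1})) = (XU₀ m, YU₀ m)`).  This file PRODUCES that block — ★★ `exists_referenceBlock` — by applying
-w8 g14's FILE-1 `exists_tateUnit_and_forall_readingHom_moment_eq_of_readingField` (p774607) with NO units (`J := PEmpty`) at the
modulus `𝔪 = 𝔠r = ((1 − α₀)³)`, from: the frame at `v`, the lane's `ℤ₂`-datum (piece (a) `exists_ltDatum_of_frame`), the model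
lattice and Grössencharacter (piece (b) `exists_modelLattice_grossencharacter`: `hLE hΩE h₂ h₃ hψv hψspan h6 h7`), Q-θ (`hτK`), a reading
field `E₀ ⊇ e(K(𝔣ψ·(1 − α₀)³))` with its `α`-datum (-w8 g14's `exists_readingField`), and the two `𝔓`-integrality ORACLES `hIx hIy`
(de Shalit II.4.9 (i), pointwise; hypotheses in FILE-3b's binder shapes, discharged by cf2c-w4 g17).

THEOREMS ONLY; nothing is closed; no summit statement is proved by this seat; BSD is not proved by any of this.

References: [deShalit1987] E. de Shalit, *Iwasawa theory of elliptic curves with complex multiplication* (1987), II §1.5 (15), II §4.2 (6),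
II §4.4 (11)–(12) (iv), II §4.7 (16), II §4.9 (i); [SilvermanAEC2009] J. H. Silverman, *The Arithmetic of Elliptic Curves* (2009), III.1,
VI.3.6 (b); [NeukirchANT1999] J. Neukirch, *Algebraic Number Theory* (1999), Ch. VI §7 (7.1).
-/

-- the summit namespace `Summit.BirchSwinnertonDyer.BirchSwinnertonDyer` repeats the problem name by design (D-0017)
set_option linter.dupNamespace false
set_option autoImplicit false

noncomputable section

open scoped Classical
open scoped NumberField nonZeroDivisors
open PowerSeries IsDedekindDomain IsDedekindDomain.HeightOneSpectrum NumberField ValuativeRel Field PeriodPair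
open Literature.NumberTheory.NumberFields Literature.NumberTheory.EllipticCurves Literature.NumberTheory.EllipticCurves.DeShalit1987
  Literature.NumberTheory.EllipticCurves.DivisionPointReadings Literature.NumberTheory.ComplexMultiplication.EllipticUnits
open Literature.NumberTheory.GaloisRepresentations Literature.NumberTheory.GaloisRepresentations.IsNonarchimedeanLocalField
  Literature.NumberTheory.GaloisRepresentations.LubinTate Literature.NumberTheory.EllipticCurves.FormalGroupChart Literature.NumberTheory.PAdicHodge
  _root_.WeierstrassCurve
open Literature.NumberTheory.LFunctions.AbelianDensity (artinSymbol)

namespace Summit.BirchSwinnertonDyer.BirchSwinnertonDyer.Theorems.PrintCf2.KatzMeasureJZeroSeam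

attribute [local instance] ltNormUniformSpace ltNormIsUniformAddGroup rk1 nF nE fintypeResidueField

variable {K : Type} [Field K] [NumberField K]

set_option maxHeartbeats 3200000 in
/-- ★★ **THE REFERENCE BLOCK** (see the module docstring): `β_r`, the complex and local readings of the `v`-division points of
`Ω_ref = Ω_E/w₀((1 − α₀)³)` in `E₀·K_v(W[v^{m+1}])`, and the Tate unit `a₀` with its point property — the binders
`βr hβr xu₀ yu₀ XU₀ YU₀ hxu₀ hyu₀ hXU₀ hYU₀ a₀ ha₀` of `forall_label_moment_eq_at_level`, for a given reading field `E₀` with `α`-datum.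
[cite: deShalit1987, II §4.4 (11)–(12) (iv), II §4.7 (16), II §4.9 (i)] [cite: SilvermanAEC2009, III.1, VI.3.6 (b)]
[cite: NeukirchANT1999, Ch. VI §7 (7.1)] -/
theorem exists_referenceBlock
    -- the base field, the split prime `v = (α₀) ∣ 2` of degree one, `v̄ = (1 − α₀)`
    [IsTotallyComplex K] (v : HeightOneSpectrum (𝓞 K)) [v.asIdeal.LiesOver (ratPlace 2).asIdeal]
    (he : v.asIdeal.ramificationIdx (𝓞 ℚ) = 1) (hf : v.asIdeal.inertiaDeg (𝓞 ℚ) = 1)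
    {α₀ : 𝓞 K} (hv0 : v.asIdeal = Ideal.span {α₀}) (hα₀ : α₀ ^ 2 - α₀ + 2 = 0) (hprime₁ : Prime (1 - α₀))
    (hq : residueFieldCard (v.adicCompletion K) = 2)
    (h2 : (valuation (v.adicCompletion K)).IsUniformizer ((((2 : ℕ) : 𝒪[v.adicCompletion K]) : v.adicCompletion K)))
    (u : 𝒪[v.adicCompletion K]ˣ)
    -- the lane's `ℤ₂`-datum
    {c : ℤ_[2]} {P : PowerSeries ℤ_[2]}
    (hPexp : P.map PadicInt.Coe.ringHom = ((⟨1, -1, 0, -2, -1⟩ : WeierstrassCurve ℤ_[2]).map PadicInt.Coe.ringHom).formalExp.subst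
      (C (c : ℚ_[2]) * ((⟨1, -1, 0, -2, -1⟩ : WeierstrassCurve ℤ_[2]).map PadicInt.Coe.ringHom).formalLog))
    (hA : IsLTRing c 2) (hPlt : IsLTSeries c 2 P)
    (heπ : ((integerEquivAdicCompletionIntegers v).trans (padicIntEquivOfDegreeOne K 2 v he hf))
      ((u : 𝒪[v.adicCompletion K]) * ((2 : ℕ) : 𝒪[v.adicCompletion K])) = c)
    (hc : padicEquivOfDegreeOne K 2 v he hf (algebraMap K (v.adicCompletion K) (α₀ : K)) = c)
    (hV : (((⟨1, -1, 0, -2, -1⟩ : WeierstrassCurve ℤ)).map (Int.castRingHom ℤ_[2])).formalGroupLaw = ltF hA hPlt)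
    {ϖ : ℤ_[2]} (hp : ((2 : ℕ) : ℤ_[2]) = ϖ * c) (hϖ : IsUnit ϖ)
    -- the reference reading field `E₀ ⊇ e(K(𝔣ψ·(1 − α₀)³))` (finite Galois unramified) with its `α`-datum at `𝔑 = 𝔣ψ·(1 − α₀)⁴`
    (E₀ : IntermediateField (v.adicCompletion K) (AlgebraicClosure (v.adicCompletion K)))
    [FiniteDimensional (v.adicCompletion K) E₀] [IsGalois (v.adicCompletion K) E₀]
    (hE₀ : E₀ ≤ maxUnramified (v.adicCompletion K)) {σ₀ : absoluteGaloisGroup (v.adicCompletion K)} (hσ₀ : IsAbsArithFrob σ₀)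
    [hEll₀ : ∀ m : ℕ, (curveOver (E₀ ⊔ ltField ((u : 𝒪[v.adicCompletion K]) * ((2 : ℕ) : 𝒪[v.adicCompletion K])) m :
        IntermediateField (v.adicCompletion K) (AlgebraicClosure (v.adicCompletion K)))
      ((((⟨1, -1, 0, -2, -1⟩ : WeierstrassCurve ℤ)).map (Int.castRingHom ℤ_[2])).map ((LTCoeff.of (v.adicCompletion K)).toRingHom.comp
        ((integerEquivAdicCompletionIntegers v).trans (padicIntEquivOfDegreeOne K 2 v he hf)).symm.toRingHom))).IsElliptic]
    {𝔣ψ : Ideal (𝓞 K)} (h𝔣ψ0 : 𝔣ψ ≠ ⊥) (hv𝔣ψ : ¬ 𝔣ψ ≤ v.asIdeal)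
    (hE₀r : ∀ y : AlgebraicClosure K, y ∈ rayClassField K (𝔣ψ * Ideal.span {(1 - α₀) ^ 3}) →
      absClosureEmbedding K (v.adicCompletion K) y ∈ E₀)
    {f₀ : ℕ} (hαf0 : (α₀ ^ f₀ : 𝓞 K) ≠ 0) (hαf𝔑 : (α₀ ^ f₀ : 𝓞 K) - 1 ∈ 𝔣ψ * (Ideal.span {(1 - α₀) ^ 3} * Ideal.span {1 - α₀}))
    (hαfw : ∀ w : HeightOneSpectrum (𝓞 K), w ≠ v → (α₀ ^ f₀ : 𝓞 K) ∉ w.asIdeal)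
    (hαfπ : (((α₀ ^ f₀ : 𝓞 K) : K) : v.adicCompletion K) =
      ((((u : 𝒪[v.adicCompletion K]) * ((2 : ℕ) : 𝒪[v.adicCompletion K]) : 𝒪[v.adicCompletion K]) : v.adicCompletion K)) ^ f₀)
    (hdegE₀ : ∀ w : WeilGroup (v.adicCompletion K),
      WeilGroup.toAbsGalois (v.adicCompletion K) w ∈ E₀.fixingSubgroup → (f₀ : ℤ) ∣ WeilGroup.deg w)
    -- the two readings `θ`, `ι_p` conjugate through `τ_K` (Q-θ); `w₀ : K → ℂ`
    (θ : CompletedAlgClosure (v.adicCompletion K) →+* ℂ_[2]) (ιp : PadicAlgCl 2 ≃+* ℂ) (w₀ : InfinitePlace K) {τK : absoluteGaloisGroup K}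
    (hτK : ∀ x : AlgebraicClosure K,
      θ (algClosureToC (v.adicCompletion K) (absClosureEmbedding K (v.adicCompletion K) (τK • x))) =
        algebraMap (PadicAlgCl 2) ℂ_[2] (ιp.symm (algClosureEmb w₀.embedding x)))
    -- the model lattice `Λ_L = Ω_E·w₀(𝓞_K)` of `W ⊗ ℂ`
    (L : PeriodPair) {ΩE : ℂ} (hLE : ∀ z : ℂ, z ∈ L.lattice ↔ ∃ a : 𝓞 K, z = ΩE * w₀.embedding (a : K)) (hΩE : ΩE ≠ 0)
    (h₂ : L.g₂ = (((⟨1, -1, 0, -2, -1⟩ : WeierstrassCurve ℤ)).baseChange ℂ).c₄ / 12)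
    (h₃ : L.g₃ = (((⟨1, -1, 0, -2, -1⟩ : WeierstrassCurve ℤ)).baseChange ℂ).c₆ / 216)
    -- the Grössencharacter: (iii), `ψ(v) = α₀`, (vi), (vii)
    (ψK : Ideal (𝓞 K) → 𝓞 K)
    (hψspan : ∀ 𝔞 : Ideal (𝓞 K), IsCoprime 𝔞 𝔣ψ → Ideal.span {ψK 𝔞} = 𝔞) (hψv : ψK v.asIdeal = α₀)
    (h6 : ∀ 𝔠 : Ideal (𝓞 K), 𝔠 ≠ ⊥ → ∀ z : ℂ, z ∈ idealInvLattice w₀.embedding 𝔠 L.lattice → z ∉ L.lattice →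
      ∃ x y : rayClassField K (𝔣ψ * 𝔠), algClosureEmb w₀.embedding x = ℘[L] z ∧ algClosureEmb w₀.embedding y = ℘'[L] z)
    (h7 : ∀ 𝔠 : Ideal (𝓞 K), 𝔠 ≠ ⊥ → ∀ z : ℂ, z ∈ idealInvLattice w₀.embedding 𝔠 L.lattice → z ∉ L.lattice →
      ∀ 𝔟 : Ideal (𝓞 K), IsCoprime 𝔟 (𝔣ψ * 𝔠) → ∀ x y : rayClassField K (𝔣ψ * 𝔠),
        algClosureEmb w₀.embedding x = ℘[L] z → algClosureEmb w₀.embedding y = ℘'[L] z →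
          algClosureEmb w₀.embedding (artinSymbol (galFrob K (rayClassField K (𝔣ψ * 𝔠))) 𝔟 x) = ℘[L] (w₀.embedding (ψK 𝔟 : K) * z) ∧
          algClosureEmb w₀.embedding (artinSymbol (galFrob K (rayClassField K (𝔣ψ * 𝔠))) 𝔟 y) = ℘'[L] (w₀.embedding (ψK 𝔟 : K) * z))
    -- the two `𝔓`-integrality ORACLES used here (de Shalit II.4.9 (i), pointwise; hypotheses)
    (hIx : ∀ (𝔠 : Ideal (𝓞 K)), 𝔠 ≠ ⊥ → ¬ 𝔠 ≤ v.asIdeal → ∀ z : ℂ, z ∈ idealInvLattice w₀.embedding 𝔠 L.lattice → z ∉ L.lattice →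
      ∀ {𝔐 : Ideal (𝓞 K)} (F : IntermediateField (v.adicCompletion K) (AlgebraicClosure (v.adicCompletion K)))
        [FiniteDimensional (v.adicCompletion K) F]
        (hF : ∀ y : AlgebraicClosure K, y ∈ rayClassField K 𝔐 → absClosureEmbedding K (v.adicCompletion K) y ∈ F) (X : rayClassField K 𝔐),
        algClosureEmb w₀.embedding X = ℘[L] z - (((⟨1, -1, 0, -2, -1⟩ : WeierstrassCurve ℤ)).baseChange ℂ).b₂ / 12 → X ∈ readingRing F hF)
    (hIy : ∀ (𝔠 : Ideal (𝓞 K)), 𝔠 ≠ ⊥ → ¬ 𝔠 ≤ v.asIdeal → ∀ z : ℂ, z ∈ idealInvLattice w₀.embedding 𝔠 L.lattice → z ∉ L.lattice →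
      ∀ {𝔐 : Ideal (𝓞 K)} (F : IntermediateField (v.adicCompletion K) (AlgebraicClosure (v.adicCompletion K)))
        [FiniteDimensional (v.adicCompletion K) F]
        (hF : ∀ y : AlgebraicClosure K, y ∈ rayClassField K 𝔐 → absClosureEmbedding K (v.adicCompletion K) y ∈ F) (Y : rayClassField K 𝔐),
        algClosureEmb w₀.embedding Y = (℘'[L] z - (((⟨1, -1, 0, -2, -1⟩ : WeierstrassCurve ℤ)).baseChange ℂ).a₁ *
          (℘[L] z - (((⟨1, -1, 0, -2, -1⟩ : WeierstrassCurve ℤ)).baseChange ℂ).b₂ / 12) - (((⟨1, -1, 0, -2, -1⟩ : WeierstrassCurve ℤ)).baseChange ℂ).a₃) / 2 →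
        Y ∈ readingRing F hF) :
    ∃ (βr : 𝓞 K) (xu₀ yu₀ : ℕ → AlgebraicClosure K)
      (XU₀ YU₀ : ∀ m : ℕ, ↥(E₀ ⊔ ltField ((u : 𝒪[v.adicCompletion K]) * ((2 : ℕ) : 𝒪[v.adicCompletion K])) m :
        IntermediateField (v.adicCompletion K) (AlgebraicClosure (v.adicCompletion K))))
      (a₀ : 𝒪[v.adicCompletion K]ˣ),
      βr * α₀ - 1 ∈ Ideal.span {(1 - α₀) ^ 3} ∧
      (∀ m : ℕ, algClosureEmb w₀.embedding (xu₀ m) =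
        ℘[L] (w₀.embedding ((βr ^ (m + 1) : 𝓞 K) : K) * (ΩE / w₀.embedding (((1 - α₀) ^ 3 : 𝓞 K) : K)) -
          (ΩE / w₀.embedding (((1 - α₀) ^ 3 : 𝓞 K) : K)) / w₀.embedding ((α₀ ^ (m + 1) : 𝓞 K) : K)) -
          (((⟨1, -1, 0, -2, -1⟩ : WeierstrassCurve ℤ)).baseChange ℂ).b₂ / 12) ∧
      (∀ m : ℕ, algClosureEmb w₀.embedding (yu₀ m) =
        (℘'[L] (w₀.embedding ((βr ^ (m + 1) : 𝓞 K) : K) * (ΩE / w₀.embedding (((1 - α₀) ^ 3 : 𝓞 K) : K)) -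
            (ΩE / w₀.embedding (((1 - α₀) ^ 3 : 𝓞 K) : K)) / w₀.embedding ((α₀ ^ (m + 1) : 𝓞 K) : K)) -
          (((⟨1, -1, 0, -2, -1⟩ : WeierstrassCurve ℤ)).baseChange ℂ).a₁ *
            (℘[L] (w₀.embedding ((βr ^ (m + 1) : 𝓞 K) : K) * (ΩE / w₀.embedding (((1 - α₀) ^ 3 : 𝓞 K) : K)) -
              (ΩE / w₀.embedding (((1 - α₀) ^ 3 : 𝓞 K) : K)) / w₀.embedding ((α₀ ^ (m + 1) : 𝓞 K) : K)) -
              (((⟨1, -1, 0, -2, -1⟩ : WeierstrassCurve ℤ)).baseChange ℂ).b₂ / 12) - (((⟨1, -1, 0, -2, -1⟩ : WeierstrassCurve ℤ)).baseChange ℂ).a₃) / 2) ∧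
      (∀ m, ((XU₀ m : ↥(E₀ ⊔ ltField ((u : 𝒪[v.adicCompletion K]) * ((2 : ℕ) : 𝒪[v.adicCompletion K])) m :
          IntermediateField (v.adicCompletion K) (AlgebraicClosure (v.adicCompletion K)))) : AlgebraicClosure (v.adicCompletion K)) =
        (absClosureEmbedding K (v.adicCompletion K)).toRingHom (xu₀ m)) ∧
      (∀ m, ((YU₀ m : ↥(E₀ ⊔ ltField ((u : 𝒪[v.adicCompletion K]) * ((2 : ℕ) : 𝒪[v.adicCompletion K])) m :
          IntermediateField (v.adicCompletion K) (AlgebraicClosure (v.adicCompletion K)))) : AlgebraicClosure (v.adicCompletion K)) =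
        (absClosureEmbedding K (v.adicCompletion K)).toRingHom (yu₀ m)) ∧
      (∀ (m : ℕ) (h : (curveOver (E₀ ⊔ ltField ((u : 𝒪[v.adicCompletion K]) * ((2 : ℕ) : 𝒪[v.adicCompletion K])) m :
            IntermediateField (v.adicCompletion K) (AlgebraicClosure (v.adicCompletion K)))
          ((((⟨1, -1, 0, -2, -1⟩ : WeierstrassCurve ℤ)).map (Int.castRingHom ℤ_[2])).map ((LTCoeff.of (v.adicCompletion K)).toRingHom.comp
            ((integerEquivAdicCompletionIntegers v).trans (padicIntEquivOfDegreeOne K 2 v he hf)).symm.toRingHom))).toAffine.Nonsingular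
          (XU₀ m) (YU₀ m)),
        ptOfZ (E₀ ⊔ ltField ((u : 𝒪[v.adicCompletion K]) * ((2 : ℕ) : 𝒪[v.adicCompletion K])) m :
            IntermediateField (v.adicCompletion K) (AlgebraicClosure (v.adicCompletion K)))
            ((((⟨1, -1, 0, -2, -1⟩ : WeierstrassCurve ℤ)).map (Int.castRingHom ℤ_[2])).map ((LTCoeff.of (v.adicCompletion K)).toRingHom.comp
              ((integerEquivAdicCompletionIntegers v).trans (padicIntEquivOfDegreeOne K 2 v he hf)).symm.toRingHom))
            (evalPt₁ (maxNilIdeal (v.adicCompletion K) (E₀ ⊔ ltField ((u : 𝒪[v.adicCompletion K]) * ((2 : ℕ) : 𝒪[v.adicCompletion K])) m :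
                IntermediateField (v.adicCompletion K) (AlgebraicClosure (v.adicCompletion K))))
              (hom (isLTRing_LTCoeff (isUniformizer_unit_mul h2 u))
                (isLTSeries_map_LTCoeff_of_degree_one ((integerEquivAdicCompletionIntegers v).trans (padicIntEquivOfDegreeOne K 2 v he hf))
                  hq heπ hPlt) (isLTSeries_LTCoeff _) 1)
              (constantCoeff_hom _ _ _ 1)
              (evalPt₁ (maxNilIdeal (v.adicCompletion K) (E₀ ⊔ ltField ((u : 𝒪[v.adicCompletion K]) * ((2 : ℕ) : 𝒪[v.adicCompletion K])) m :
                  IntermediateField (v.adicCompletion K) (AlgebraicClosure (v.adicCompletion K))))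
                (hom (isLTRing_LTCoeff (isUniformizer_unit_mul h2 u)) (isLTSeries_LTCoeff _) (isLTSeries_LTCoeff _)
                  (LTCoeff.of (v.adicCompletion K) (a₀ : 𝒪[v.adicCompletion K])))
                (constantCoeff_hom _ _ _ _)
                (inclPt (le_sup_right : ltField ((u : 𝒪[v.adicCompletion K]) * ((2 : ℕ) : 𝒪[v.adicCompletion K])) m ≤
                    E₀ ⊔ ltField ((u : 𝒪[v.adicCompletion K]) * ((2 : ℕ) : 𝒪[v.adicCompletion K])) m)
                  (cohPt (isUniformizer_unit_mul h2 u) m)))) =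
          (.some (XU₀ m) (YU₀ m) h : (curveOver (E₀ ⊔ ltField ((u : 𝒪[v.adicCompletion K]) * ((2 : ℕ) : 𝒪[v.adicCompletion K])) m :
              IntermediateField (v.adicCompletion K) (AlgebraicClosure (v.adicCompletion K)))
            ((((⟨1, -1, 0, -2, -1⟩ : WeierstrassCurve ℤ)).map (Int.castRingHom ℤ_[2])).map ((LTCoeff.of (v.adicCompletion K)).toRingHom.comp
              ((integerEquivAdicCompletionIntegers v).trans (padicIntEquivOfDegreeOne K 2 v he hf)).symm.toRingHom))).toAffine.Point)) := by
  haveI : CharZero (v.adicCompletion K) := charZero_of_injective_algebraMap (algebraMap K (v.adicCompletion K)).injective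
  -- ### §0 the split-prime block `2 = α₀(1 − α₀)`, `α₀ + (1 − α₀) = 1`
  have h2K : (2 : 𝓞 K) = α₀ * (1 - α₀) := KatzMeasureJZeroTop.two_eq_generator_mul_one_sub hα₀
  have htr : α₀ + (1 - α₀) = 1 := KatzMeasureJZeroTop.generator_add_one_sub α₀
  have hprime : Prime α₀ := KatzMeasureJZeroTop.prime_of_generator hv0
  have hndvd : ¬ α₀ ∣ 1 - α₀ := KatzMeasureJZeroTop.not_dvd_one_sub_of_generator hv0
  have hπ₁3 : ((1 - α₀) ^ 3 : 𝓞 K) ≠ 0 := pow_ne_zero _ hprime₁.ne_zero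
  -- `v` is coprime to every ideal it does not contain
  have hcopv : ∀ I : Ideal (𝓞 K), ¬ I ≤ v.asIdeal → IsCoprime v.asIdeal I := fun I hI ↦ by
    rw [Ideal.isCoprime_iff_sup_eq]
    by_contra hne
    exact hI ((v.isMaximal.eq_of_le hne le_sup_left).symm ▸ le_sup_right)
  have hα₀v : α₀ ∈ v.asIdeal := by rw [hv0]; exact Ideal.mem_span_singleton_self _
  have hπ₁v : (1 - α₀ : 𝓞 K) ∉ v.asIdeal := fun h ↦ by
    have h1 := v.asIdeal.add_mem hα₀v h
    rw [htr] at h1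
    exact v.isPrime.ne_top ((Ideal.eq_top_iff_one _).mpr h1)
  -- ### §1 the modulus `𝔪 = ((1 − α₀)³)` (reading conductor `𝔠r := 𝔪`) and `𝔑 = 𝔣ψ·𝔪·(1 − α₀)`
  have h𝔪0 : Ideal.span {((1 - α₀) ^ 3 : 𝓞 K)} ≠ ⊥ := by
    rw [Ne, Ideal.span_singleton_eq_bot]; exact hπ₁3
  have h𝔪1 : Ideal.span {((1 - α₀) ^ 3 : 𝓞 K)} ≠ ⊤ := ne_top_of_le_span_pow hprime₁ (n := 3) (by norm_num) le_rfl
  have hα𝔪 : ∀ k : ℕ, (α₀ ^ k : 𝓞 K) ∉ Ideal.span {((1 - α₀) ^ 3 : 𝓞 K)} :=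
    pow_notMem_of_le_span_pow hprime₁ htr (n := 3) (by norm_num) le_rfl
  have hv𝔪 : ¬ Ideal.span {((1 - α₀) ^ 3 : 𝓞 K)} ≤ v.asIdeal := fun h ↦
    hπ₁v (v.isPrime.mem_of_pow_mem 3 (h (Ideal.mem_span_singleton_self _)))
  have h𝔠0 : 𝔣ψ * Ideal.span {((1 - α₀) ^ 3 : 𝓞 K)} ≠ ⊥ := mul_ne_zero h𝔣ψ0 h𝔪0
  have hv𝔠 : ¬ 𝔣ψ * Ideal.span {((1 - α₀) ^ 3 : 𝓞 K)} ≤ v.asIdeal := fun h ↦ (v.isPrime.mul_le.mp h).elim hv𝔣ψ hv𝔪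
  have h𝔑1 : Ideal.span {(1 - α₀ : 𝓞 K)} ≠ ⊥ := by rw [Ne, Ideal.span_singleton_eq_bot]; exact hprime₁.ne_zero
  have hv𝔑1 : ¬ Ideal.span {(1 - α₀ : 𝓞 K)} ≤ v.asIdeal := fun h ↦ hπ₁v (h (Ideal.mem_span_singleton_self _))
  have h𝔑0 : 𝔣ψ * (Ideal.span {((1 - α₀) ^ 3 : 𝓞 K)} * Ideal.span {(1 - α₀ : 𝓞 K)}) ≠ ⊥ :=
    mul_ne_zero h𝔣ψ0 (mul_ne_zero h𝔪0 h𝔑1)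
  have hv𝔑 : ¬ 𝔣ψ * (Ideal.span {((1 - α₀) ^ 3 : 𝓞 K)} * Ideal.span {(1 - α₀ : 𝓞 K)}) ≤ v.asIdeal := fun h ↦
    (v.isPrime.mul_le.mp h).elim hv𝔣ψ fun h' ↦ (v.isPrime.mul_le.mp h').elim hv𝔪 hv𝔑1
  -- `β_r` with `β_r α₀ ≡ 1 (mod 𝔪)`
  obtain ⟨βr, hβr⟩ := KatzMeasureJZeroTop.exists_mul_generator_sub_one_mem hv𝔪 hv0
  -- `ι(α₀)² = ι(α₀) − 2`
  have hw : w₀.embedding (α₀ : K) ^ 2 = w₀.embedding (α₀ : K) - 2 := by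
    have h1 : ((α₀ : K)) ^ 2 - (α₀ : K) + 2 = 0 := by
      have := congrArg ((↑) : 𝓞 K → K) hα₀
      push_cast at this
      exact this
    have h2 := congrArg w₀.embedding h1
    simp only [map_add, map_sub, map_pow, map_ofNat, map_zero] at h2
    linear_combination h2
  -- ### §2 the reference presentation `Λ_L = Ω_ref·w₀(𝔪)`, `Ω_ref = Ω_E/w₀((1 − α₀)³)`
  have hL : ∀ z : ℂ, z ∈ L.lattice ↔ ∃ a ∈ Ideal.span {((1 - α₀) ^ 3 : 𝓞 K)},
      z = ΩE / w₀.embedding (((1 - α₀) ^ 3 : 𝓞 K) : K) * w₀.embedding (a : K) :=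
    modelLattice_spec_of_span_singleton_eq w₀.embedding hLE hπ₁3 rfl
  have hΩ : ΩE / w₀.embedding (((1 - α₀) ^ 3 : 𝓞 K) : K) ≠ 0 := modelLattice_scale_ne_zero w₀.embedding hΩE hπ₁3
  have hΩ𝔪 : ΩE / w₀.embedding (((1 - α₀) ^ 3 : 𝓞 K) : K) ∈ idealInvLattice w₀.embedding (Ideal.span {((1 - α₀) ^ 3 : 𝓞 K)}) L.lattice :=
    mem_idealInvLattice_of_model w₀.embedding hL
  have hΩL : ΩE / w₀.embedding (((1 - α₀) ^ 3 : 𝓞 K) : K) ∉ L.lattice := notMem_lattice_of_model w₀.embedding hL hΩ h𝔪1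
  have hπΩ𝔪 : w₀.embedding ((α₀ : 𝓞 K) : K) * (ΩE / w₀.embedding (((1 - α₀) ^ 3 : 𝓞 K) : K)) ∈
      idealInvLattice w₀.embedding (Ideal.span {((1 - α₀) ^ 3 : 𝓞 K)}) L.lattice := by
    simpa only [pow_one] using mul_pow_mem_idealInvLattice_of_model w₀.embedding hL α₀ 1
  have hπΩL : w₀.embedding ((α₀ : 𝓞 K) : K) * (ΩE / w₀.embedding (((1 - α₀) ^ 3 : 𝓞 K) : K)) ∉ L.lattice :=
    mul_gen_notMem w₀.embedding hL hΩ (by simpa only [pow_one] using hα𝔪 1)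
  -- the `v̄`-division point `ub = Ω_ref·w₀((1 − α₀)²)` and `2Ω_ref, 2α₀Ω_ref ∉ L`
  have hub1 : w₀.embedding ((1 - α₀ : 𝓞 K) : K) * (ΩE / w₀.embedding (((1 - α₀) ^ 3 : 𝓞 K) : K) *
      w₀.embedding (((1 - α₀) ^ 2 : 𝓞 K) : K)) ∈ L.lattice :=
    (hL _).mpr ⟨(1 - α₀) ^ 3, Ideal.mem_span_singleton_self _, by
      push_cast; simp only [map_pow, map_sub, map_one]; ring⟩
  have hub0 : ΩE / w₀.embedding (((1 - α₀) ^ 3 : 𝓞 K) : K) * w₀.embedding (((1 - α₀) ^ 2 : 𝓞 K) : K) ∉ L.lattice := by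
    rw [mul_mem_lattice_iff_of_model w₀.embedding hL hΩ, Ideal.mem_span_singleton]
    intro h
    have := (pow_dvd_pow_iff hprime₁.ne_zero hprime₁.not_unit).mp h
    omega
  have h2Ω : (2 : ℂ) * (ΩE / w₀.embedding (((1 - α₀) ^ 3 : 𝓞 K) : K)) ∉ L.lattice := by
    have e1 : (2 : ℂ) * (ΩE / w₀.embedding (((1 - α₀) ^ 3 : 𝓞 K) : K)) =
        ΩE / w₀.embedding (((1 - α₀) ^ 3 : 𝓞 K) : K) * w₀.embedding (((2 : 𝓞 K) : 𝓞 K) : K) := by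
      have e0 : (((2 : 𝓞 K) : 𝓞 K) : K) = 2 := by
        rw [← one_add_one_eq_two]; push_cast; norm_num
      rw [e0, map_ofNat]; ring
    rw [e1, mul_mem_lattice_iff_of_model w₀.embedding hL hΩ]
    exact two_notMem_of_le_span_sq hprime₁ htr h2K (le_span_sq_of_le_span_cube le_rfl)
  have h2Ω₁ : (2 : ℂ) * (w₀.embedding ((α₀ : 𝓞 K) : K) * (ΩE / w₀.embedding (((1 - α₀) ^ 3 : 𝓞 K) : K))) ∉ L.lattice := by
    have e1 : (2 : ℂ) * (w₀.embedding ((α₀ : 𝓞 K) : K) * (ΩE / w₀.embedding (((1 - α₀) ^ 3 : 𝓞 K) : K))) =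
        ΩE / w₀.embedding (((1 - α₀) ^ 3 : 𝓞 K) : K) * w₀.embedding (((2 * α₀ : 𝓞 K) : 𝓞 K) : K) := by
      have e0 : (((2 * α₀ : 𝓞 K) : 𝓞 K) : K) = 2 * ((α₀ : 𝓞 K) : K) := by
        rw [two_mul, two_mul]; norm_cast
      rw [e0, map_mul, map_ofNat]; ring
    rw [e1, mul_mem_lattice_iff_of_model w₀.embedding hL hΩ, Ideal.mem_span_singleton, h2K,
      show α₀ * (1 - α₀) * α₀ = (1 - α₀) ^ 1 * α₀ ^ 2 by ring]
    intro h
    have h' : (1 - α₀) * (1 - α₀) ^ 2 ∣ (1 - α₀) * α₀ ^ 2 := by convert h using 1 <;> ring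
    have h1 : (1 - α₀) ^ 2 ∣ α₀ ^ 2 := (mul_dvd_mul_iff_left hprime₁.ne_zero).mp h'
    exact not_dvd_of_add_eq_one hprime₁ htr (hprime₁.dvd_of_dvd_pow ((dvd_pow_self _ two_ne_zero).trans h1))
  -- ### §3 the model coordinates of `ξ(Ω_ref)`, `ξ(α₀Ω_ref)` at the level `K(𝔣ψ𝔪)` (clause (vi)) and their `𝔓`-integrality (oracles)
  obtain ⟨x₀, y₀, hx₀, hy₀⟩ := h6 _ h𝔪0 _ hΩ𝔪 hΩL
  obtain ⟨x₁, y₁, hx₁, hy₁⟩ := h6 _ h𝔪0 _ hπΩ𝔪 hπΩL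
  obtain ⟨hX₀, hY₀⟩ := algClosureEmb_modelCoords w₀.embedding (rayClassField K (𝔣ψ * Ideal.span {((1 - α₀) ^ 3 : 𝓞 K)})) hx₀ hy₀
  obtain ⟨hX₁, hY₁⟩ := algClosureEmb_modelCoords w₀.embedding (rayClassField K (𝔣ψ * Ideal.span {((1 - α₀) ^ 3 : 𝓞 K)})) hx₁ hy₁
  have hX₀i := hIx _ h𝔪0 hv𝔪 _ hΩ𝔪 hΩL E₀ hE₀r _ hX₀
  have hY₀i := hIy _ h𝔪0 hv𝔪 _ hΩ𝔪 hΩL E₀ hE₀r _ hY₀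
  have hX₁i := hIx _ h𝔪0 hv𝔪 _ hπΩ𝔪 hπΩL E₀ hE₀r _ hX₁
  have hY₁i := hIy _ h𝔪0 hv𝔪 _ hπΩ𝔪 hπΩL E₀ hE₀r _ hY₁
  -- ### §4 the ideal `𝔟` with `τ_K⁻¹|_{K(𝔣ψ𝔪)} = (𝔟, ·)`, an inverse `δ` of `ψ(𝔟)` mod `𝔪`, clause (vii) at `𝔟, v, 𝔟v`
  obtain ⟨𝔟, h𝔟0, h𝔟cop, h𝔟art⟩ := exists_ideal_artinSymbol_eq_absRestrictNormalHom h𝔠0 τK⁻¹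
  have hψ𝔟 : Ideal.span {ψK 𝔟} = 𝔟 := hψspan 𝔟 h𝔟cop.of_mul_right_left
  have h𝔟𝔪 : IsCoprime (Ideal.span {ψK 𝔟}) (Ideal.span {((1 - α₀) ^ 3 : 𝓞 K)}) := by rw [hψ𝔟]; exact h𝔟cop.of_mul_right_right
  obtain ⟨δ, hδ⟩ : ∃ δ : 𝓞 K, δ * ψK 𝔟 - 1 ∈ Ideal.span {((1 - α₀) ^ 3 : 𝓞 K)} := by
    obtain ⟨a, ha, b, hb, hab⟩ := Ideal.isCoprime_iff_exists.mp h𝔟𝔪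
    obtain ⟨δ, rfl⟩ := Ideal.mem_span_singleton'.mp ha
    exact ⟨δ, by rw [show δ * ψK 𝔟 - 1 = -b by rw [← hab]; ring]; exact Submodule.neg_mem _ hb⟩
  have hvii : ∀ 𝔟' ∈ ({𝔟, v.asIdeal, 𝔟 * v.asIdeal} : Set (Ideal (𝓞 K))), ∀ z : ℂ,
      z ∈ idealInvLattice w₀.embedding (Ideal.span {((1 - α₀) ^ 3 : 𝓞 K)}) L.lattice → z ∉ L.lattice →
      ∀ x y : rayClassField K (𝔣ψ * Ideal.span {((1 - α₀) ^ 3 : 𝓞 K)}),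
        algClosureEmb w₀.embedding x = ℘[L] z → algClosureEmb w₀.embedding y = ℘'[L] z →
        algClosureEmb w₀.embedding (artinSymbol (galFrob K (rayClassField K (𝔣ψ * Ideal.span {((1 - α₀) ^ 3 : 𝓞 K)}))) 𝔟' x) =
            ℘[L] (w₀.embedding (ψK 𝔟' : K) * z) ∧
        algClosureEmb w₀.embedding (artinSymbol (galFrob K (rayClassField K (𝔣ψ * Ideal.span {((1 - α₀) ^ 3 : 𝓞 K)}))) 𝔟' y) =
            ℘'[L] (w₀.embedding (ψK 𝔟' : K) * z) := by
    intro 𝔟' h𝔟' z hz hzL x y hx hy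
    simp only [Set.mem_insert_iff, Set.mem_singleton_iff] at h𝔟'
    have hc' : IsCoprime 𝔟' (𝔣ψ * Ideal.span {((1 - α₀) ^ 3 : 𝓞 K)}) := by
      rcases h𝔟' with rfl | rfl | rfl
      · exact h𝔟cop
      · exact hcopv _ hv𝔠
      · exact h𝔟cop.mul_left (hcopv _ hv𝔠)
    exact h7 _ h𝔪0 z hz hzL 𝔟' hc' x y hx hy
  -- ### §5 FILE-1 with NO units (`J := PEmpty`) at `𝔪 = 𝔠r = ((1 − α₀)³)`
  obtain ⟨xu, yu, XU, YU, a, hxu, hyu, hXU, hYU, ha, -⟩ :=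
    exists_tateUnit_and_forall_readingHom_moment_eq_of_readingField v he hf hq h2 u hPexp hA hPlt heπ
      (⟨1, -1, 0, -2, -1⟩ : WeierstrassCurve ℤ) rfl hV hp hϖ E₀ hE₀ hσ₀ (𝔣ψ := 𝔣ψ) (𝔠r := Ideal.span {((1 - α₀) ^ 3 : 𝓞 K)})
      hE₀r h𝔠0 hv𝔠 h𝔑0 hv𝔑 hαf0 hαf𝔑 hαfw hαfπ hdegE₀ θ ιp w₀ hτK hv0 h2K htr hprime hndvd hc hw
      (𝔪 := Ideal.span {((1 - α₀) ^ 3 : 𝓞 K)}) h𝔪1 hprime₁ le_rfl le_rfl hβr le_rfl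
      (J := PEmpty.{1}) (fun i ↦ i.elim) (fun i ↦ i.elim) (fun i ↦ i.elim) (fun i ↦ i.elim) (fun i ↦ i.elim) (fun i ↦ i.elim)
      L (fun i ↦ i.elim) (fun i ↦ i.elim) (fun i ↦ i.elim) (fun i ↦ i.elim) hL hΩ h₂ h₃ hub1 hub0 h2Ω h2Ω₁
      ψK hψv h6 h𝔟0 h𝔟art.symm hvii hδ (fun i ↦ i.elim) (fun i ↦ i.elim)
      _ _ _ _ hX₀ hY₀ hX₁ hY₁ hX₀i hY₀i hX₁i hY₁i
      (fun i ↦ i.elim) (fun i ↦ i.elim) (fun i ↦ i.elim) (fun i ↦ i.elim) (fun i ↦ i.elim) (fun i ↦ i.elim) (fun i ↦ i.elim)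
  exact ⟨βr, xu, yu, XU, YU, a, hβr, hxu, hyu, hXU, hYU, ha⟩

end Summit.BirchSwinnertonDyer.BirchSwinnertonDyer.Theorems.PrintCf2.KatzMeasureJZeroSeam

end
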